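import Mathlib

/-!
# PercRepro — nullity and small circuits: Lemma N and Corollary N′ (night-1, gen 0)

`proofs/NIGHT-1-C025-induction.md` §10 (Theorem C, C-025 at bounded corank and large rank) rests on two elementary
matroid facts, stated here additively in `ℕ∞` (no subtraction):

* **`eRk_union_circuit_add`** (LEMMA N, nullity increment): for a circuit `C ⊄ X`,
  `r(X ∪ C) + |X ∩ C| + 1 ≤ r(X) + |C|` — submodularity plus «a proper subset of a circuit is independent»;
  **`eRk_union_circuit_add'`**: the same as `r(X ∪ C) + 1 + |X| ≤ r(X) + |X ∪ C|`, i.e. the nullity `|·| − r(·)` grows by at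
  least one when a circuit not inside `X` is added;
* **`encard_listUnion_add_le`** (COROLLARY N′; `listUnion`, `listUnion_finite`): for a list of circuits `C₁, …, C_m` each of size `≤ k`, the union `U`
  satisfies `|U| + k·r(U) ≤ k·|U|`, i.e. `|U| ≤ k·(|U| − r(U)) ≤ k·ν(E)` — the union of all circuits of size `≤ k` of a
  matroid of nullity `d` has at most `k·d` elements (induction along the list: a circuit inside the union so far changes
  nothing, a circuit not inside it raises the nullity by one and the size by at most `k`).
Imports Mathlib only. Axioms: standard.
-/

namespace PercRepro

namespace Matroid

open Set

variable {α : Type*} {M : _root_.Matroid α}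

/-- **Lemma N (nullity increment), additive form**: for a circuit `C` not contained in `X`,
`r(X ∪ C) + |X ∩ C| + 1 ≤ r(X) + |C|`. -/
theorem eRk_union_circuit_add {X C : Set α} (hC : M.IsCircuit C) (hCX : ¬ C ⊆ X) :
    M.eRk (X ∪ C) + (X ∩ C).encard + 1 ≤ M.eRk X + C.encard := by
  have hsub := M.eRk_submod X C
  have hssub : X ∩ C ⊂ C := by
    refine ⟨inter_subset_right, fun h => hCX (fun x hx => (h hx).1)⟩
  have hind : M.Indep (X ∩ C) := hC.ssubset_indep hssub
  have h1 : M.eRk (X ∩ C) = (X ∩ C).encard := hind.eRk_eq_encard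
  have h2 := hC.eRk_add_one_eq
  calc M.eRk (X ∪ C) + (X ∩ C).encard + 1 = M.eRk (X ∩ C) + M.eRk (X ∪ C) + 1 := by rw [h1]; ring
    _ ≤ M.eRk X + M.eRk C + 1 := by gcongr
    _ = M.eRk X + C.encard := by rw [← h2]; ring

/-- **Lemma N, nullity form**: for a finite `X` and a circuit `C ⊄ X`, `r(X ∪ C) + 1 + |X| ≤ r(X) + |X ∪ C|`
(«`ν(X ∪ C) ≥ ν(X) + 1`»). -/
theorem eRk_union_circuit_add' {X C : Set α} (hC : M.IsCircuit C) (hCX : ¬ C ⊆ X) (hX : X.Finite) :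
    M.eRk (X ∪ C) + 1 + X.encard ≤ M.eRk X + (X ∪ C).encard := by
  have h := eRk_union_circuit_add hC hCX
  have hunion : (X ∪ C).encard + (X ∩ C).encard = X.encard + C.encard := encard_union_add_encard_inter X C
  have hfin : (X ∩ C).encard ≠ ⊤ := (hX.subset inter_subset_left).encard_lt_top.ne
  -- add `|X|` to both sides of `h`, replace `|X| + |C|` by `|X ∪ C| + |X ∩ C|`, cancel `|X ∩ C|`
  have h' : M.eRk (X ∪ C) + 1 + X.encard + (X ∩ C).encard ≤ M.eRk X + (X ∪ C).encard + (X ∩ C).encard := by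
    calc M.eRk (X ∪ C) + 1 + X.encard + (X ∩ C).encard
        = (M.eRk (X ∪ C) + (X ∩ C).encard + 1) + X.encard := by ring
      _ ≤ (M.eRk X + C.encard) + X.encard := by gcongr
      _ = M.eRk X + (X.encard + C.encard) := by ring
      _ = M.eRk X + ((X ∪ C).encard + (X ∩ C).encard) := by rw [hunion]
      _ = M.eRk X + (X ∪ C).encard + (X ∩ C).encard := by ring
  exact (WithTop.add_le_add_iff_right hfin).1 h'

/-- The union of a list of sets. -/
def listUnion : List (Set α) → Set α
  | [] => ∅
  | C :: L => listUnion L ∪ C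

/-- The union of a list of finite sets is finite. -/
theorem listUnion_finite (L : List (Set α)) (hfin : ∀ C ∈ L, C.Finite) : (listUnion L).Finite := by
  induction L with
  | nil => simp [listUnion]
  | cons D L ihL =>
    simp only [listUnion]
    exact (ihL (fun D' hD' => hfin D' (List.mem_cons_of_mem D hD'))).union (hfin D List.mem_cons_self)

/-- **Corollary N′**: if every member of the list `L` is a circuit with at most `k` elements, then the union `U`
satisfies `|U| + k·r(U) ≤ k·|U|` — i.e. `|U| ≤ k·(|U| − r(U))`, so the union of all circuits of size `≤ k` has at most
`k · ν(E)` elements (`|U| − r(U) ≤ |E| − r(E)`). -/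
theorem encard_listUnion_add_le (k : ℕ) (L : List (Set α))
    (hL : ∀ C ∈ L, M.IsCircuit C ∧ C.encard ≤ k) (hfin : ∀ C ∈ L, C.Finite) :
    (listUnion L).encard + k * M.eRk (listUnion L) ≤ k * (listUnion L).encard := by
  induction L with
  | nil =>
    simp only [listUnion, encard_empty, Matroid.eRk_empty, mul_zero, add_zero, le_refl]
  | cons C L ih =>
    have hC := hL C List.mem_cons_self
    have ih' := ih (fun D hD => hL D (List.mem_cons_of_mem C hD)) (fun D hD => hfin D (List.mem_cons_of_mem C hD))
    have hUfin : (listUnion L).Finite := listUnion_finite L (fun D hD => hfin D (List.mem_cons_of_mem C hD))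
    simp only [listUnion]
    set U := listUnion L with hU
    by_cases hCU : C ⊆ U
    · rw [union_eq_left.2 hCU]
      exact ih'
    · -- Lemma N: `r(U ∪ C) + 1 + |U| ≤ r(U) + |U ∪ C|`; and `|U ∪ C| ≤ |U| + k`
      have hN := eRk_union_circuit_add' hC.1 hCU hUfin
      have hsize : (U ∪ C).encard ≤ U.encard + k :=
        (encard_union_le U C).trans (by gcongr; exact hC.2)
      have hUfin' : U.encard ≠ ⊤ := hUfin.encard_lt_top.ne
      have hrU : M.eRk U ≠ ⊤ := (M.eRk_le_encard U).trans_lt hUfin.encard_lt_top |>.ne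
      -- multiply Lemma N by `k` and add the induction hypothesis
      have hk : (k : ℕ∞) * (M.eRk (U ∪ C) + 1 + U.encard) ≤ k * (M.eRk U + (U ∪ C).encard) := by gcongr
      -- goal: `|U ∪ C| + k r(U ∪ C) ≤ k |U ∪ C|`
      -- from `hk`: `k r(U ∪ C) + k + k|U| ≤ k r(U) + k|U ∪ C|`; from `ih'`: `|U| + k r(U) ≤ k|U|`
      have hk' : k * M.eRk (U ∪ C) + k + k * U.encard ≤ k * M.eRk U + k * (U ∪ C).encard := by
        have := hk
        rw [mul_add, mul_add, mul_one, mul_add] at this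
        exact this
      -- sum and cancel `k r(U)` and `k |U|`
      have hsum : (U ∪ C).encard + k * M.eRk (U ∪ C) + (k * M.eRk U + k * U.encard) ≤
          k * (U ∪ C).encard + (k * M.eRk U + k * U.encard) := by
        calc (U ∪ C).encard + k * M.eRk (U ∪ C) + (k * M.eRk U + k * U.encard)
            ≤ (U.encard + k) + k * M.eRk (U ∪ C) + (k * M.eRk U + k * U.encard) := by gcongr
          _ = (k * M.eRk (U ∪ C) + k + k * U.encard) + (U.encard + k * M.eRk U) := by ring
          _ ≤ (k * M.eRk U + k * (U ∪ C).encard) + (k * U.encard) := by gcongr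
          _ = k * (U ∪ C).encard + (k * M.eRk U + k * U.encard) := by ring
      have hne : k * M.eRk U + k * U.encard ≠ ⊤ := by
        refine WithTop.add_ne_top.2 ⟨?_, ?_⟩
        · exact WithTop.mul_ne_top (WithTop.natCast_ne_top k) hrU
        · exact WithTop.mul_ne_top (WithTop.natCast_ne_top k) hUfin'
      exact (WithTop.add_le_add_iff_right hne).1 hsum

end Matroid

end PercRepro
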